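import Literature.MathematicalPhysics.KineticTheory.HardSphereUniformGas
import HarnessLib

/-!
# Marginals of the hard-core canonical measure on `𝕋³`
# (helper toward the rung-0 collision-count bound; crux `JParityClosure.OddContactSymmetry`,
# stmt-AtomisticToContinuum-13078, line `equilibrium-rung-mean-variance`, transfer debt "tightness")

Lead prover r-1 of the crux.  The static input of the first-moment collision-count argument at rung 0:
under the configurational canonical measure `posGibbsMeasure (const a) ε_N (N+1)` of `N + 1` hard
spheres of diameter `ε_N = σ(N+1)^{-1/3}` on the unit flat torus, at reduced density `v₁ σ³ ≤ 1/2`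
(`v₁ = |B(0,1)|`), the law of the positions of any set `I` of labels is dominated by `2^{|I|}` times
Haar measure (`posGibbsMeasure_marginal_le`): drop the hard-core constraints involving `I`
(`hardCoreSet_anti`), factorise the product integral over the disjoint label sets
(`pi_inter_hardCoreSet_eq`, independence of coordinates), identify the remaining hard-core
probability with `Ξ_N(N+1-|I|)` by label symmetry, and bound the insertion ratio
`Ξ_N(N+1-|I|)/Ξ_N(N+1) ≤ (1 - v₁σ³)^{-|I|} ≤ 2^{|I|}` (`rN_le` of the canonical cluster-expansion files).

References: Spohn 1991, Part I §2.1–2.3 (canonical hard-sphere measure); Pulvirenti–Tsagkarogiannis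
2012 §3 (insertion bounds in the canonical ensemble).
-/

noncomputable section

open MeasureTheory Set Filter Topology
open scoped ENNReal BigOperators

namespace Summit.AtomisticToContinuum.HydrodynamicLimit.Theorems

open Literature.Analysis.FluidPDE Literature.MathematicalPhysics.KineticTheory
  Literature.MathematicalPhysics.StatisticalMechanics

/-- The one-particle law of the uniform profile is the Haar probability measure of `𝕋³`
(`β ≡ 1`, `withDensity 1 = id`). [folklore] -/
theorem uniformProfile_μ : uniformProfile.μ = (volume : Measure T3) := by
  show volume.withDensity (fun _ : T3 => ENNReal.ofReal 1) = volume
  rw [ENNReal.ofReal_one]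
  exact withDensity_one

/-- The `n`-fold product of the one-particle law of the uniform profile is the Haar (product
Lebesgue) measure of `(𝕋³)ⁿ`. [folklore] -/
theorem pi_uniformProfile_μ (n : ℕ) :
    (Measure.pi fun _ : Fin n => uniformProfile.μ) = (volume : Measure (Fin n → T3)) := by
  rw [uniformProfile_μ]
  rfl

/-- The hard-core set is antitone in the label set: the hard-core constraints of fewer labels
define a larger set of configurations. [folklore] -/
theorem hardCoreSet_anti {ι X : Type*} (O : X → X → Prop) {W W' : Finset ι} (h : W ⊆ W') :
    (hardCoreSet O W' : Set (ι → X)) ⊆ hardCoreSet O W :=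
  fun _ hx i hi j hj hij => hx i (h hi) j (h hj) hij

/-- **Independence of disjoint coordinates under the product law.** For an event `B` depending
only on the coordinates labelled by `I`, the probability (under the product of the uniform
one-particle laws) of `B` intersected with the hard-core event of the labels off `I` is the product
of the two probabilities (`integral_mul_eq_of_dependsOn` for the two indicators). [folklore] -/
theorem pi_inter_hardCoreSet_eq (ε : ℝ) {n : ℕ} (I : Finset (Fin n)) {B : Set (Fin n → T3)}
    (hB : MeasurableSet B)
    (hBI : ∀ x y : Fin n → T3, (∀ i ∈ I, x i = y i) → (x ∈ B ↔ y ∈ B)) :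
    Measure.pi (fun _ : Fin n => uniformProfile.μ) (B ∩ hardCoreSet (Ov ε) (Finset.univ \ I)) =
      Measure.pi (fun _ : Fin n => uniformProfile.μ) B *
        ENNReal.ofReal (hcProb (Ov ε) uniformProfile.μ (Finset.univ \ I)) := by
  have hHC : MeasurableSet (hardCoreSet (Ov ε) (Finset.univ \ I) : Set (Fin n → T3)) :=
    measurableSet_hardCoreSet (measurableSet_ov ε) _
  have hdepB : DependsOn (B.indicator (1 : (Fin n → T3) → ℝ)) ((I : Finset (Fin n)) : Set (Fin n)) := by
    intro x y hxy
    have hiff : x ∈ B ↔ y ∈ B := hBI x y fun i hi => hxy i (Finset.mem_coe.2 hi)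
    by_cases hx : x ∈ B
    · rw [indicator_of_mem hx, indicator_of_mem (hiff.1 hx)]; rfl
    · rw [indicator_of_notMem hx, indicator_of_notMem (fun hy => hx (hiff.2 hy))]
  have hreal : (Measure.pi fun _ : Fin n => uniformProfile.μ).real
        (B ∩ hardCoreSet (Ov ε) (Finset.univ \ I)) =
      (Measure.pi fun _ : Fin n => uniformProfile.μ).real B *
        hcProb (Ov ε) uniformProfile.μ (Finset.univ \ I) := by
    rw [← integral_indicator_one (hB.inter hHC), ← integral_indicator_one hB,
      ← integral_efR uniformProfile.μ (measurableSet_ov ε) (Finset.univ \ I),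
      ← integral_mul_eq_of_dependsOn uniformProfile.μ Finset.disjoint_sdiff
        (measurable_one.indicator hB) (measurable_efR (measurableSet_ov ε) _) hdepB
        (dependsOn_efR _)]
    refine integral_congr_ae (ae_of_all _ fun x => ?_)
    show _ = B.indicator 1 x * efR (Ov ε) x (Finset.univ \ I)
    rw [efR_eq_indicator, inter_indicator_one]
    rfl
  rw [measureReal_def, measureReal_def] at hreal
  rw [← ENNReal.ofReal_toReal (measure_ne_top _ (B ∩ _)),
    ← ENNReal.ofReal_toReal (measure_ne_top (Measure.pi fun _ : Fin n => uniformProfile.μ) B),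
    ← ENNReal.ofReal_mul ENNReal.toReal_nonneg, hreal]

/-- **(S0) Marginals of the hard-core canonical measure.** Under the configurational canonical measure of
`N + 1` hard spheres of diameter `ε_N = σ (N+1)^{-1/3}` on `𝕋³` with constant activity, at reduced
density `v₁ σ³ ≤ 1/2`, the probability of an event depending only on the positions of the particles of
a label set `I` is at most `2^{|I|}` times its Haar (product Lebesgue) measure: dropping the hard-core
constraints that involve `I` only increases the weight, and removing `|I|` particles costs at most the
factor `(Ξ_N(N+1-|I|)/Ξ_N(N+1)) ≤ (1 - v₁σ³)^{-|I|} ≤ 2^{|I|}` (insertion bound). [folklore] -/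
theorem posGibbsMeasure_marginal_le {a σ : ℝ} (ha : 0 < a) (hσ : 0 < σ) (hσ2 : σ < 1 / 2)
    (hlam : v₁ * σ ^ 3 ≤ 1 / 2) (N : ℕ) (I : Finset (Fin (N + 1)))
    {B : Set (Fin (N + 1) → T3)} (hB : MeasurableSet B)
    (hBI : ∀ x y : Fin (N + 1) → T3, (∀ i ∈ I, x i = y i) → (x ∈ B ↔ y ∈ B)) :
    posGibbsMeasure (fun _ : T3 => a) (hsDiameter σ N) (N + 1) B ≤ 2 ^ I.card * volume B := by
  have hlam1 : ovDensity uniformProfile σ < 1 := by rw [ovDensity_uniformProfile]; linarith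
  have hk : I.card ≤ N + 1 := (Finset.card_le_univ I).trans_eq (Fintype.card_fin _)
  -- label symmetry: `Ξ(univ \ I) = Ξ_N(N + 1 - |I|)`
  have hXi : hcProb (Ov (hsDiameter σ N)) uniformProfile.μ (Finset.univ \ I) =
      Xi uniformProfile (hsDiameter σ N) (N + 1) (N + 1 - I.card) := by
    rw [Xi]
    refine hcProb_eq_of_card_eq uniformProfile.μ (measurableSet_ov _) ?_
    rw [Finset.card_univ_sdiff, Fintype.card_fin, card_firstLabels (Nat.sub_le _ _)]
  -- the insertion (ratio) bound `Ξ_N(N+1-|I|) / Ξ_N(N+1) ≤ (1 - v₁σ³)^{-|I|} ≤ 2^{|I|}`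
  have hr : (Xi uniformProfile (hsDiameter σ N) (N + 1) (N + 1))⁻¹ *
      Xi uniformProfile (hsDiameter σ N) (N + 1) (N + 1 - I.card) ≤ 2 ^ I.card := by
    have h1 := rN_le (P := uniformProfile) (N := N) (m := N + 1) (j := I.card) hσ.le hσ2 hlam1
      le_rfl hk
    rw [rN, XiN, XiN, div_eq_inv_mul] at h1
    refine h1.trans (pow_le_pow_left₀ (inv_nonneg.2 (by linarith)) ?_ _)
    rw [ovDensity_uniformProfile]
    have hx : (1 : ℝ) / 2 ≤ 1 - v₁ * σ ^ 3 := by linarith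
    calc (1 - v₁ * σ ^ 3)⁻¹ ≤ (1 / 2)⁻¹ := inv_anti₀ (by norm_num) hx
      _ = 2 := by norm_num
  rw [posGibbsMeasure_eq continuous_const (fun _ => ha), profileOf_const ha, Measure.smul_apply,
    Measure.restrict_apply hB, smul_eq_mul]
  calc ENNReal.ofReal (Xi uniformProfile (hsDiameter σ N) (N + 1) (N + 1))⁻¹ *
        Measure.pi (fun _ : Fin (N + 1) => uniformProfile.μ)
          (B ∩ hardCoreSet (Ov (hsDiameter σ N)) Finset.univ)
      ≤ ENNReal.ofReal (Xi uniformProfile (hsDiameter σ N) (N + 1) (N + 1))⁻¹ *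
          Measure.pi (fun _ : Fin (N + 1) => uniformProfile.μ)
            (B ∩ hardCoreSet (Ov (hsDiameter σ N)) (Finset.univ \ I)) := by
        gcongr
        exact hardCoreSet_anti (Ov (hsDiameter σ N))
          (Finset.sdiff_subset (s := (Finset.univ : Finset (Fin (N + 1)))) (t := I))
    _ = ENNReal.ofReal ((Xi uniformProfile (hsDiameter σ N) (N + 1) (N + 1))⁻¹ *
          Xi uniformProfile (hsDiameter σ N) (N + 1) (N + 1 - I.card)) *
          Measure.pi (fun _ : Fin (N + 1) => uniformProfile.μ) B := by
        rw [pi_inter_hardCoreSet_eq _ I hB hBI, hXi,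
          ENNReal.ofReal_mul (inv_nonneg.2 (Xi_nonneg _))]
        ring
    _ ≤ ENNReal.ofReal (2 ^ I.card) * Measure.pi (fun _ : Fin (N + 1) => uniformProfile.μ) B := by
        gcongr
    _ = 2 ^ I.card * volume B := by
        rw [ENNReal.ofReal_pow zero_le_two, ENNReal.ofReal_ofNat, pi_uniformProfile_μ]


/-- **Registered helper stub `stub_hardCoreMarginal`** of crux stmt-AtomisticToContinuum-13078
(rung-0 collision-count bound, part 3: marginals of the hard-core canonical measure;
= `posGibbsMeasure_marginal_le` in signature form). [folklore] -/
theorem stub_hardCoreMarginal :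
    ∀ (a σ : ℝ), 0 < a → 0 < σ → σ < 1 / 2 → v₁ * σ ^ 3 ≤ 1 / 2 → ∀ (N : ℕ) (I : Finset (Fin (N + 1))) (B : Set (Fin (N + 1) → T3)), MeasurableSet B → (∀ x y : Fin (N + 1) → T3, (∀ i ∈ I, x i = y i) → (x ∈ B ↔ y ∈ B)) → posGibbsMeasure (fun _ : T3 => a) (hsDiameter σ N) (N + 1) B ≤ 2 ^ I.card * volume B :=
  fun _a _σ ha hσ hσ2 hlam N I _B hB hBI => posGibbsMeasure_marginal_le ha hσ hσ2 hlam N I hB hBI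

end Summit.AtomisticToContinuum.HydrodynamicLimit.Theorems

end
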